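import Summits.CriticalPhenomena.PercolationContinuityZ3.Theorems.PercNearOneGluingNoHeavyPcintDefectWordCensus
import HarnessLib

/-!
# CriticalPhenomena/PercolationContinuityZ3 — Theorems/PercNearOneGluingNoHeavyPcintDefectWordStructure.lean: a one-defect return word is COMPATIBLE with a one-defect structure (combinatorial core of STRUCTURE law C5-L4, part 3b)

Lane prim-pcint, STRUCTURE rule «numerics ⇒ structure ⇒ conjecture» (prim-pcint-2 GEN 21); sequel of …PcintDefectWordCensus.
Given the one-defect census of a word of length `2j + 1` on `ℤ^j` (axis `c⋆` with `(c⋆, β)` twice and `(c⋆, ¬β)` once or twice, …Census) and its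
partner diagram `dpi`, mark the two same-letter chords on the axis `c⋆` by their openers `u₁` (first `(c⋆, β)`) and `t₁` (first `(c⋆, ¬β)`):
* the 4-block of the marked pair is exactly the set of points whose letter lies on `c⋆` (`Census.mem_quad_iff_fst`), the closing point carrying
  the VIRTUAL LETTER `vletter` (the lone letter itself if it lies on `c⋆`, else its reverse);
* the extended word is FULLY COMPATIBLE with `(dpi, u₁, t₁)` (`Census.fcompat`; …PcintDefectWordDiagram `FCompat`), and `(min, max)` of the two
  openers is a marked pair (`Census.isPair`);
whence **`exists_fcompat`**: every word of length `2j + 1` on `ℤ^j` using all axes and ending next to the origin is fully compatible with some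
one-defect structure `(π, a, b)`.  With …PcintDefectWordDiagram it is then self-avoiding iff both switched diagrams are irreducible; uniqueness
and the fibre count follow in …PcintDefectWordUnique / …PcintDefectWordCount.

HONEST FRAMING: elementary finite combinatorics written for the mechanism theorem of law C5-L4 (all `m`).  No `sorry`; standard axioms.
Written by prim-pcint-2 gen 21 (prover-prim-pcint-2-g21-0), 2026-08-27.
-/

noncomputable section

namespace Summit.CriticalPhenomena.PercolationContinuityZ3.Theorems.Pcint.ChordDiag

open Literature.Probability.LatticeModels Literature.Probability.Percolation
open Summit.CriticalPhenomena.PercolationContinuityZ3.Theorems.Pcint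
open Summit.CriticalPhenomena.PercolationContinuityZ3.Theorems.Pcint.MemoryTail

variable {n j : ℕ}

/-! ### The marked chords and full compatibility -/

section Build

variable {w : Fin n → Fin j × Bool} {cs : Fin j} {β : Bool} {ℓ u₁ t₁ : Fin n}

/-- The virtual closing letter: the lone letter itself if it lies on the defect axis, else its reverse. [folklore] -/
def vletter (w : Fin n → Fin j × Bool) (cs : Fin j) (ℓ : Fin n) : Fin j × Bool := if (w ℓ).1 = cs then w ℓ else srev (w ℓ)

/-- The virtual letter lies on the axis of the lone letter. [folklore] -/
theorem vletter_fst (w : Fin n → Fin j × Bool) (cs : Fin j) (ℓ : Fin n) : (vletter w cs ℓ).1 = (w ℓ).1 := by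
  unfold vletter; split_ifs <;> rfl

/-- Off the defect axis two distinct letters on one axis are mutually reversed, and the reverse occurs exactly once. [folklore] -/
theorem Census.srev_of_ne (hC : Census w cs β) {s s' : Fin n} (hss : s ≠ s') (hc : (w s).1 ≠ cs) (hax : (w s).1 = (w s').1) :
    w s' = srev (w s) ∧ cnt w (w s).1 (!(w s).2) = 1 ∧ cnt w (w s).1 (w s).2 = 1 := by
  have h1 := hC.cnt_le_one hc (w s).2
  have h1' := hC.cnt_le_one hc (!(w s).2)
  have hs := one_le_cnt_self w s
  have hne : w s' ≠ w s := by
    intro he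
    have h2 : 2 ≤ cnt w (w s).1 (w s).2 := by
      unfold cnt
      have hsub : ({s, s'} : Finset (Fin n)) ⊆ Finset.univ.filter fun t => w t = ((w s).1, (w s).2) := by
        intro t ht'
        rw [Finset.mem_insert, Finset.mem_singleton] at ht'
        rcases ht' with rfl | rfl <;> simp [he]
      have := Finset.card_le_card hsub
      rwa [Finset.card_pair hss] at this
    omega
  have hrev : w s' = srev (w s) := by
    have h2 : (w s').2 ≠ (w s).2 := fun h => hne (Prod.ext hax.symm h)
    refine Prod.ext hax.symm ?_
    simp only [srev]
    cases hb : (w s).2 <;> cases hb' : (w s').2 <;> simp_all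
  have hs' := one_le_cnt_self w s'
  rw [hrev] at hs'
  simp only [srev] at hs'
  exact ⟨hrev, by omega, by omega⟩

/-- Off the defect axis a letter whose reverse does not occur is lone. [folklore] -/
theorem Census.partner_eq_opp_or_lone (hC : Census w cs β) {s : Fin n} (hc : (w s).1 ≠ cs) :
    (cnt w (w s).1 (!(w s).2) = 1 ∧ partner w s = Fin.castSucc (opp w s) ∧ w (opp w s) = srev (w s)) ∨ IsLone w s := by
  have h2 : cnt w (w s).1 (w s).2 ≠ 2 := by have := hC.cnt_le_one hc (w s).2; omega
  by_cases h1 : cnt w (w s).1 (!(w s).2) = 1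
  · exact Or.inl ⟨h1, partner_of_one h2 h1, opp_spec h1⟩
  · exact Or.inr ⟨h2, h1⟩

/-- The first marked chord: the doubled letter `u₁` is partnered with its twin. [folklore] -/
theorem Census.partner_u (hC : Census w cs β) (hu : w u₁ = (cs, β)) :
    partner w u₁ = Fin.castSucc (twin w u₁) ∧ twin w u₁ ≠ u₁ ∧ w (twin w u₁) = w u₁ := by
  have h2 : cnt w (w u₁).1 (w u₁).2 = 2 := by rw [hu]; exact hC.1
  exact ⟨partner_of_two h2, twin_spec h2⟩

/-- The second marked chord: `t₁` (letter `(cs, ¬β)`) is partnered with its twin, or is the lone letter. [folklore] -/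
theorem Census.partner_t (hC : Census w cs β) (hℓ : IsLone w ℓ) (ht : w t₁ = (cs, !β)) :
    (partner w t₁ = Fin.castSucc (twin w t₁) ∧ twin w t₁ ≠ t₁ ∧ w (twin w t₁) = w t₁) ∨ (partner w t₁ = Fin.last n ∧ t₁ = ℓ) := by
  by_cases h2 : cnt w (w t₁).1 (w t₁).2 = 2
  · exact Or.inl ⟨partner_of_two h2, twin_spec h2⟩
  · have hl : IsLone w t₁ := by
      refine ⟨h2, ?_⟩
      rw [ht]; simp only [Bool.not_not]; rw [hC.1]; decide
    exact Or.inr ⟨partner_of_lone hl, hC.lone_unique hl hℓ⟩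

/-- A letter on the defect axis is `u₁`, its twin, `t₁`, or the partner of `t₁`. [folklore] -/
theorem Census.mem_quad_of_fst (hC : Census w cs β) (hℓ : IsLone w ℓ) (hu : w u₁ = (cs, β)) (ht : w t₁ = (cs, !β)) {s : Fin n}
    (hs : (w s).1 = cs) : Fin.castSucc s ∈ quad (dpi w ℓ) (Fin.castSucc u₁) (Fin.castSucc t₁) := by
  rw [mem_quad, dpi_castSucc, dpi_castSucc]
  obtain ⟨hpu, htu, hwu⟩ := hC.partner_u hu
  by_cases hb : (w s).2 = β
  · have hws : w s = (cs, β) := Prod.ext hs hb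
    rcases eq_or_eq_of_cnt_two hC.1 hu (hwu.trans hu) htu.symm hws with h | h
    · exact Or.inl (by rw [h])
    · exact Or.inr (Or.inl (by rw [hpu, h]))
  · have hws : w s = (cs, !β) := Prod.ext hs (by cases β <;> cases h' : (w s).2 <;> simp_all)
    rcases hC.partner_t hℓ ht with ⟨hpt, htt, hwt⟩ | ⟨hpt, rfl⟩
    · have h2 : cnt w cs (!β) = 2 := by
        have : cnt w (w t₁).1 (w t₁).2 = 2 := by
          by_contra h2; rw [partner_of_lone] at hpt
          · exact absurd hpt (Fin.castSucc_lt_last _).ne'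
          · refine ⟨h2, ?_⟩; rw [ht]; simp only [Bool.not_not]; rw [hC.1]; decide
        rwa [ht] at this
      rcases eq_or_eq_of_cnt_two h2 ht (hwt.trans ht) htt.symm hws with h | h
      · exact Or.inr (Or.inr (Or.inl (by rw [h])))
      · exact Or.inr (Or.inr (Or.inr (by rw [hpt, h])))
    · -- `t₁ = ℓ` is the single letter `(cs, ¬β)`
      have h1 : cnt w cs (!β) = 1 := by
        have hle := hC.cnt_le_two cs (!β)
        have hge := hC.one_le_cnt_odl
        have hne : cnt w cs (!β) ≠ 2 := by have := hℓ.1; rwa [ht] at this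
        omega
      exact Or.inr (Or.inr (Or.inl (by rw [eq_of_cnt_eq_one h1 hws ht])))

/-- **The 4-block is the defect axis**: a point lies in `Q` iff its (extended) letter lies on `cs`. [folklore] -/
theorem Census.mem_quad_iff_fst (hC : Census w cs β) (hℓ : IsLone w ℓ) (hu : w u₁ = (cs, β)) (ht : w t₁ = (cs, !β))
    (x : Fin (n + 1)) :
    x ∈ quad (dpi w ℓ) (Fin.castSucc u₁) (Fin.castSucc t₁) ↔ (ext w (vletter w cs ℓ) x).1 = cs := by
  obtain ⟨hpu, htu, hwu⟩ := hC.partner_u hu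
  constructor
  · intro hx
    rw [mem_quad, dpi_castSucc, dpi_castSucc, hpu] at hx
    rcases hx with rfl | rfl | rfl | rfl
    · rw [ext_castSucc, hu]
    · rw [ext_castSucc, hwu, hu]
    · rw [ext_castSucc, ht]
    · rcases hC.partner_t hℓ ht with ⟨hpt, -, hwt⟩ | ⟨hpt, hteq⟩
      · rw [hpt, ext_castSucc, hwt, ht]
      · rw [hpt, ext_last, vletter_fst, ← hteq, ht]
  · intro hx
    induction x using Fin.lastCases with
    | cast s => rw [ext_castSucc] at hx; exact hC.mem_quad_of_fst hℓ hu ht hx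
    | last =>
      rw [ext_last, vletter_fst] at hx
      -- the lone letter on the defect axis is the single letter `(cs, ¬β)`, i.e. `t₁`
      have hws : w ℓ = (cs, !β) := by
        refine Prod.ext hx ?_
        by_contra hb
        have hb' : (w ℓ).2 = β := by cases β <;> cases h' : (w ℓ).2 <;> simp_all
        exact hℓ.1 (by rw [hx, hb']; exact hC.1)
      have h1 : cnt w cs (!β) = 1 := by
        have hle := hC.cnt_le_two cs (!β)
        have hge := hC.one_le_cnt_odl
        have hne : cnt w cs (!β) ≠ 2 := by have := hℓ.1; rwa [hws] at this
        omega
      have hteq : t₁ = ℓ := eq_of_cnt_eq_one h1 ht hws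
      rw [mem_quad, dpi_castSucc, dpi_castSucc, partner_of_lone (hteq ▸ hℓ : IsLone w t₁)]
      exact Or.inr (Or.inr (Or.inr rfl))

/-- **Full compatibility of a one-defect word with its structure.** [folklore] -/
theorem Census.fcompat (hC : Census w cs β) (hℓ : IsLone w ℓ) (hu : w u₁ = (cs, β)) (ht : w t₁ = (cs, !β)) :
    FCompat (dpi w ℓ) (Fin.castSucc u₁) (Fin.castSucc t₁) (ext w (vletter w cs ℓ)) := by
  have hQ := hC.mem_quad_iff_fst hℓ hu ht
  obtain ⟨hpu, htu, hwu⟩ := hC.partner_u hu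
  refine ⟨fun x hx => ?_, ⟨?_, ?_, ?_⟩, fun x y hxy hax => ?_⟩
  · -- off `Q`: reversed letters
    rw [hQ] at hx
    induction x using Fin.lastCases with
    | last =>
      rw [ext_last, vletter_fst] at hx
      rw [dpi_last, ext_castSucc, ext_last, vletter, if_neg hx, srev_srev]
    | cast s =>
      rw [ext_castSucc] at hx
      rw [dpi_castSucc, ext_castSucc]
      rcases hC.partner_eq_opp_or_lone hx with ⟨-, hp, hwo⟩ | hl
      · rw [hp, ext_castSucc, hwo]
      · rw [partner_of_lone hl, ext_last, hC.lone_unique hℓ hl, vletter, if_neg hx]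
  · rw [dpi_castSucc, hpu, ext_castSucc, ext_castSucc, hwu]
  · rw [dpi_castSucc, ext_castSucc]
    rcases hC.partner_t hℓ ht with ⟨hpt, -, hwt⟩ | ⟨hpt, hteq⟩
    · rw [hpt, ext_castSucc, hwt]
    · rw [hpt, ext_last, vletter, ← hteq, if_pos (by rw [ht])]
  · rw [ext_castSucc, ext_castSucc, hu, ht]; rfl
  · -- equal axes: partners, or both on the defect axis
    by_cases hc : (ext w (vletter w cs ℓ) x).1 = cs
    · exact Or.inr ⟨(hQ x).2 hc, (hQ y).2 (hax ▸ hc)⟩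
    · left
      induction x using Fin.lastCases with
      | last =>
        induction y using Fin.lastCases with
        | last => exact absurd rfl hxy
        | cast s' =>
          rw [ext_last, vletter_fst] at hax hc
          rw [ext_castSucc] at hax
          rw [dpi_last]
          by_contra hne
          have hne' : ℓ ≠ s' := fun h => hne (by rw [h])
          obtain ⟨-, h1, -⟩ := hC.srev_of_ne hne' hc hax
          exact hℓ.2 h1
      | cast s =>
        rw [ext_castSucc] at hax hc
        rw [dpi_castSucc]
        induction y using Fin.lastCases with
        | last =>
          rw [ext_last, vletter_fst] at hax
          have hsl : s = ℓ := by
            by_contra hne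
            obtain ⟨-, h1, -⟩ := hC.srev_of_ne (Ne.symm hne) (by rw [← hax]; exact hc) hax.symm
            exact hℓ.2 h1
          rw [hsl, partner_of_lone hℓ]
        | cast s' =>
          rw [ext_castSucc] at hax
          have hss : s ≠ s' := fun h => hxy (by rw [h])
          obtain ⟨hrev, h1, h1'⟩ := hC.srev_of_ne hss hc hax
          rw [partner_of_one (by omega) h1]
          congr 1
          exact eq_of_cnt_eq_one h1 (by rw [opp_spec h1]; rfl) (by rw [hrev]; rfl)

/-- **The marked pair**: `u₁` and `t₁` open two distinct chords. [folklore] -/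
theorem Census.isPair (hC : Census w cs β) (hℓ : IsLone w ℓ) (hu : w u₁ = (cs, β)) (hu1 : u₁ < twin w u₁) (ht : w t₁ = (cs, !β))
    (ht1 : ∀ s, w s = (cs, !β) → t₁ ≤ s) :
    IsPair (dpi w ℓ) (min (Fin.castSucc u₁) (Fin.castSucc t₁)) (max (Fin.castSucc u₁) (Fin.castSucc t₁)) := by
  obtain ⟨hpu, htu, hwu⟩ := hC.partner_u hu
  have hA : Fin.castSucc u₁ < dpi w ℓ (Fin.castSucc u₁) := by rw [dpi_castSucc, hpu]; exact Fin.castSucc_lt_castSucc_iff.2 hu1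
  have hB : Fin.castSucc t₁ < dpi w ℓ (Fin.castSucc t₁) := by
    rw [dpi_castSucc]
    rcases hC.partner_t hℓ ht with ⟨hpt, htt, hwt⟩ | ⟨hpt, -⟩
    · rw [hpt]; exact Fin.castSucc_lt_castSucc_iff.2 (lt_of_le_of_ne (ht1 _ (hwt.trans ht)) htt.symm)
    · rw [hpt]; exact Fin.castSucc_lt_last _
  have hne : u₁ ≠ t₁ := fun h => by
    have := hu.symm.trans (h ▸ ht); cases β <;> simp at this
  have hne' : Fin.castSucc u₁ ≠ Fin.castSucc t₁ := fun h => hne (Fin.castSucc_injective _ h)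
  have h1 : Fin.castSucc t₁ ≠ dpi w ℓ (Fin.castSucc u₁) := by
    rw [dpi_castSucc, hpu]
    intro h
    have := congrArg w (Fin.castSucc_injective _ h)
    rw [ht, hwu, hu] at this
    cases β <;> simp at this
  have h2 : Fin.castSucc u₁ ≠ dpi w ℓ (Fin.castSucc t₁) := by
    rw [dpi_castSucc]
    rcases hC.partner_t hℓ ht with ⟨hpt, -, hwt⟩ | ⟨hpt, -⟩
    · rw [hpt]; intro h
      have := congrArg w (Fin.castSucc_injective _ h)
      rw [hu, hwt, ht] at this
      cases β <;> simp at this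
    · rw [hpt]; exact (Fin.castSucc_lt_last _).ne
  rcases lt_or_gt_of_ne hne' with hlt | hlt
  · rw [min_eq_left hlt.le, max_eq_right hlt.le]; exact ⟨hA, hB, hlt, h1⟩
  · rw [min_eq_right hlt.le, max_eq_left hlt.le]; exact ⟨hB, hA, hlt, h2⟩

/-- The 4-block does not depend on the order of the marked chords. [folklore] -/
theorem quad_comm {π : Fin (n + 1) → Fin (n + 1)} (a b : Fin (n + 1)) : quad π b a = quad π a b := by
  ext x; simp only [mem_quad]; tauto

/-- Full compatibility does not depend on the order of the marked chords. [folklore] -/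
theorem FCompat.symm {π : Fin (n + 1) → Fin (n + 1)} {a b : Fin (n + 1)} {W : Fin (n + 1) → Fin j × Bool}
    (h : FCompat π a b W) : FCompat π b a W := by
  obtain ⟨h1, ⟨h2, h3, h4⟩, h5⟩ := h
  refine ⟨fun x hx => h1 x (by rwa [quad_comm] at hx), ⟨h3, h2, by rw [h4, srev_srev]⟩, fun x y hxy hax => ?_⟩
  rcases h5 x y hxy hax with h | h
  · exact Or.inl h
  · rw [quad_comm]; exact Or.inr h

/-- Full compatibility for the ordered marked pair. [folklore] -/
theorem FCompat.minmax {π : Fin (n + 1) → Fin (n + 1)} {A B : Fin (n + 1)} {W : Fin (n + 1) → Fin j × Bool}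
    (h : FCompat π A B W) : FCompat π (min A B) (max A B) W := by
  rcases le_total A B with hle | hle
  · rw [min_eq_left hle, max_eq_right hle]; exact h
  · rw [min_eq_right hle, max_eq_left hle]; exact h.symm

end Build

/-- **Every one-defect word is compatible with a one-defect structure**: a word of length `2j + 1` on `ℤ^j` using all axes and ending next to the
origin extends to a word fully compatible with some `(π, a, b)`, `π` a chord diagram and `(a, b)` a marked pair of chords. [folklore] -/
theorem exists_fcompat {w : Fin n → Fin j × Bool} (hax : ∀ c, 1 ≤ uses w c) (hl1 : l1 (wordPos w n) ≤ 1) (hn : n + 1 = 2 * j + 2) :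
    ∃ π : Fin (n + 1) → Fin (n + 1), ∃ a b : Fin (n + 1), ∃ v : Fin j × Bool, IsDiag π ∧ IsPair π a b ∧ FCompat π a b (ext w v) := by
  classical
  obtain ⟨cs, β, h2, hrest⟩ := defect_structure hax hl1 hn
  have hC : Census w cs β := ⟨h2, hrest⟩
  obtain ⟨ℓ, hℓ⟩ := hC.exists_lone
  -- the first position of the doubled letter and of the other defect letter
  have hne1 : (Finset.univ.filter fun s => w s = (cs, β)).Nonempty := by
    obtain ⟨t, -, ht⟩ := exists_ne_of_cnt_two h2 ℓ; exact ⟨t, by simp [ht]⟩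
  have hne2 : (Finset.univ.filter fun s => w s = (cs, !β)).Nonempty := by
    have := hC.one_le_cnt_odl; unfold cnt at this; exact Finset.card_pos.1 this
  set u₁ := (Finset.univ.filter fun s => w s = (cs, β)).min' hne1 with hu₁
  set t₁ := (Finset.univ.filter fun s => w s = (cs, !β)).min' hne2 with ht₁
  have hu : w u₁ = (cs, β) := (Finset.mem_filter.1 (Finset.min'_mem _ hne1)).2
  have ht : w t₁ = (cs, !β) := (Finset.mem_filter.1 (Finset.min'_mem _ hne2)).2
  have hu1 : u₁ < twin w u₁ := by
    obtain ⟨-, htu, hwu⟩ := hC.partner_u hu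
    exact lt_of_le_of_ne (Finset.min'_le _ _ (by simp [hwu, hu])) htu.symm
  have ht1 : ∀ s, w s = (cs, !β) → t₁ ≤ s := fun s hs => Finset.min'_le _ _ (by simp [hs])
  exact ⟨dpi w ℓ, _, _, vletter w cs ℓ, hC.isDiag_dpi hℓ, hC.isPair hℓ hu hu1 ht ht1, (hC.fcompat hℓ hu ht).minmax⟩

end Summit.CriticalPhenomena.PercolationContinuityZ3.Theorems.Pcint.ChordDiag
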